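import Summits.HodgeConjecture.HodgeConjecture.Theorems.SignSymmetricPowersSevenFactsKernel
import Literature.AlgebraicGeometry.HodgeTheory.UniversalHypersurfaceDiscriminantBranches
import Literature.AlgebraicGeometry.HodgeTheory.GriffithsResiduesPrimitive
import HarnessLib

/-!
# Crux K1-B `VeryGeneralSignCommutatorsInHg` and the rung leaf `SignThreefoldPowersHodge` modulo SIX cited facts —
# the discriminant's local branches (F-DISC-1) being a theorem (route `SignSymmetricPowers`,
# items stmt-HodgeConjecture-19716 / 19715)

Prover seat `hodge-nonav-prover-Bx` (g7), cell `hodge-nonav`, 2026-08-28, on the route owner's request (P3 g28,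
STATUS 01:18:06Z: "re-land the K1-B closing composition feeding `discriminant_localBranches_nodal_holds` for binder
hDisc"). Landed `--supports stmt-HodgeConjecture-19716 --as helper`; sorry-free, no definition, no new named fact.
CONDITIONAL results; nothing here says HC ∕ HC_AV is proved; rung F-H1 is not moved.

`SignSymmetricPowersSevenFacts.veryGeneralSignCommutatorsInHg_of_seven_facts` (seat Ax g4) closes K1-B from SEVEN
cited facts {hV Voisin's equivariant eigen-Hodge numbers, hZvK Zariski–van Kampen meridian generation, hPL the
Picard–Lefschetz formula for one-nodal degenerations, hGIC Deligne's global invariant cycles, hD1 the local branches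
of the discriminant at a nodal form, hCDK the Cattani–Deligne–Kaplan cover, hB2 Picard–Lefschetz for a symmetric
`A₃` pair} (the meridian-conjugacy fact hMC being already the theorem
`affineHypersurfaceComplement_meridian_isConj_holds`). The fifth — F-DISC-1,
`discriminant_localBranches_nodal` — is now the tree THEOREM `discriminant_localBranches_nodal_holds`
(`Literature/AlgebraicGeometry/HodgeTheory/UniversalHypersurfaceDiscriminantBranches.lean`, typer seat
`littype-FH1-2` g16, executing prover-B g3's plan FDISC1-PLAN). Hence:

* `veryGeneralSignCommutatorsInHg_of_six_facts` — **K1-B ⟸ {hV, hZvK, hPL, hGIC, hCDK, hB2}** — exactly the six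
  ACTIVE fact binders of the crux's registry (`stub_voisinEigenHodgeNumbers`, `stub_zvkMeridians`,
  `stub_picardLefschetzNodal`, `stub_globalInvariantCycles`, `stub_cdkCover`, `stub_plSymmetricA3`; the seventh
  active stub `stub_signPencilOrbitData` is derived from them, `SignSymmetricPowersPencilOrbitData`);
* `signThreefoldPowersHodge_of_six_facts` — the rung leaf likewise;
* `veryGeneralSignCommutatorsInHg_of_six_facts_kernel` / `…_primitive` — the same with hV replaced by Griffiths'
  residue-kernel package `Griffiths1969_residueKernel_eq_jacobianIdeal` (which implies hV's kernel form,
  `SignSymmetricPowersSignDeckHodgeKernel`) or by the residue package with primitivity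
  `Griffiths1969_residues_primitive` (which projects onto the kernel package).

## References

* [VoisinHodgeII2003] C. Voisin, Hodge Theory and Complex Algebraic Geometry II (2003), §6.1.3 Thm. 6.10 / Cor. 6.12;
  Ch. 2–3 (Lefschetz pencils, Picard–Lefschetz, Zariski's theorem).
* [Deligne1971HodgeII] P. Deligne, Théorie de Hodge II, Publ. Math. IHÉS 40 (1971), 4.1.1 (global invariant cycles).
* [CattaniDeligneKaplan1995] E. Cattani, P. Deligne, A. Kaplan, On the locus of Hodge classes, J. Amer. Math. Soc. 8
  (1995), Thm. 1.1, Cor. 1.2.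
-/

noncomputable section

open Literature.AlgebraicGeometry.Motives Literature.AlgebraicGeometry.HodgeTheory

-- mandated namespace `Summit.HodgeConjecture.HodgeConjecture.Theorems` trips `linter.dupNamespace` (off tree-wide)
set_option linter.dupNamespace false

namespace Summit.HodgeConjecture.HodgeConjecture.Theorems.SignSymmetricPowersSixFacts

/-- **Crux K1-B `VeryGeneralSignCommutatorsInHg` modulo SIX cited facts** {hV, hZvK, hPL, hGIC, hCDK, hB2}: the
seven-fact closing composition with F-DISC-1 supplied by the tree theorem `discriminant_localBranches_nodal_holds`.
CONDITIONAL; nothing here says HC ∕ HC_AV is proved.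
[cite: VoisinHodgeII2003, §6.1.3 Thm. 6.10 and Cor. 6.12] [cite: CattaniDeligneKaplan1995, Thm. 1.1 and Cor. 1.2] -/
theorem veryGeneralSignCommutatorsInHg_of_six_facts
    (hV : Literature.AlgebraicGeometry.HodgeTheory.voisin2003_finrank_eigenspace_inf_hodgePiece_of_diagonalStabilizer)
    (hZvK : Literature.AlgebraicGeometry.FundamentalGroup.affineHypersurfaceComplement_meridians_normalClosure_eq_top)
    (hPL : Literature.AlgebraicGeometry.HodgeTheory.picardLefschetz_nodalForms_uniform)
    (hGIC : Literature.AlgebraicGeometry.HodgeTheory.deligne_globalInvariantCycles)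
    (hCDK : Literature.AlgebraicGeometry.HodgeTheory.cmsp_nonHodgeGenericPoints_countable_algebraic_cover)
    (hB2 : Literature.AlgebraicGeometry.HodgeTheory.picardLefschetz_symmetricA3) :
    Summit.HodgeConjecture.HodgeConjecture.Theses.SignSymmetricPowers.VeryGeneralSignCommutatorsInHg :=
  SignSymmetricPowersSevenFacts.veryGeneralSignCommutatorsInHg_of_seven_facts @hV @hZvK @hPL @hGIC
    discriminant_localBranches_nodal_holds @hCDK @hB2

/-- **The rung leaf `SignThreefoldPowersHodge` modulo the same SIX cited facts.** CONDITIONAL; rung F-H1 not moved.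
[cite: VoisinHodgeII2003, §6.1.3 Thm. 6.10 and Cor. 6.12] [cite: CattaniDeligneKaplan1995, Thm. 1.1 and Cor. 1.2] -/
theorem signThreefoldPowersHodge_of_six_facts
    (hV : Literature.AlgebraicGeometry.HodgeTheory.voisin2003_finrank_eigenspace_inf_hodgePiece_of_diagonalStabilizer)
    (hZvK : Literature.AlgebraicGeometry.FundamentalGroup.affineHypersurfaceComplement_meridians_normalClosure_eq_top)
    (hPL : Literature.AlgebraicGeometry.HodgeTheory.picardLefschetz_nodalForms_uniform)
    (hGIC : Literature.AlgebraicGeometry.HodgeTheory.deligne_globalInvariantCycles)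
    (hCDK : Literature.AlgebraicGeometry.HodgeTheory.cmsp_nonHodgeGenericPoints_countable_algebraic_cover)
    (hB2 : Literature.AlgebraicGeometry.HodgeTheory.picardLefschetz_symmetricA3) :
    Summit.HodgeConjecture.HodgeConjecture.Theses.SignSymmetricPowers.SignThreefoldPowersHodge :=
  SignSymmetricPowersSevenFacts.signThreefoldPowersHodge_of_seven_facts @hV @hZvK @hPL @hGIC
    discriminant_localBranches_nodal_holds @hCDK @hB2

/-- **K1-B modulo SIX facts, residue-kernel form**: hV replaced by Griffiths' residue-kernel package (Voisin II
Thm. 6.10), which implies it (`SignSymmetricPowersSignDeckHodgeKernel.stub_signDeckHodge_of_residueKernel`).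
CONDITIONAL. [cite: VoisinHodgeII2003, §6.1.3 Thm. 6.10 and Cor. 6.12] [cite: CattaniDeligneKaplan1995, Thm. 1.1 and Cor. 1.2] -/
theorem veryGeneralSignCommutatorsInHg_of_six_facts_kernel
    (hG : Literature.AlgebraicGeometry.HodgeTheory.Griffiths1969_residueKernel_eq_jacobianIdeal)
    (hZvK : Literature.AlgebraicGeometry.FundamentalGroup.affineHypersurfaceComplement_meridians_normalClosure_eq_top)
    (hPL : Literature.AlgebraicGeometry.HodgeTheory.picardLefschetz_nodalForms_uniform)
    (hGIC : Literature.AlgebraicGeometry.HodgeTheory.deligne_globalInvariantCycles)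
    (hCDK : Literature.AlgebraicGeometry.HodgeTheory.cmsp_nonHodgeGenericPoints_countable_algebraic_cover)
    (hB2 : Literature.AlgebraicGeometry.HodgeTheory.picardLefschetz_symmetricA3) :
    Summit.HodgeConjecture.HodgeConjecture.Theses.SignSymmetricPowers.VeryGeneralSignCommutatorsInHg :=
  SignSymmetricPowersSevenFactsKernel.veryGeneralSignCommutatorsInHg_of_seven_facts_kernel @hG @hZvK @hPL @hGIC
    discriminant_localBranches_nodal_holds @hCDK @hB2

/-- **K1-B modulo SIX facts, residue-package form**: with Griffiths' residue package WITH primitivity (G5, the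
single residue fact shared by the two F-H1 K1 cruxes, `FH1CruxesOfResiduesPrimitive`), through its projection onto
the kernel package. CONDITIONAL. [cite: VoisinHodgeII2003, §6.1.3 Thm. 6.10 and Cor. 6.12, §6.1.2 Thm. 6.5]
[cite: CattaniDeligneKaplan1995, Thm. 1.1 and Cor. 1.2] -/
theorem veryGeneralSignCommutatorsInHg_of_six_facts_primitive
    (hG5 : Literature.AlgebraicGeometry.HodgeTheory.Griffiths1969_residues_primitive)
    (hZvK : Literature.AlgebraicGeometry.FundamentalGroup.affineHypersurfaceComplement_meridians_normalClosure_eq_top)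
    (hPL : Literature.AlgebraicGeometry.HodgeTheory.picardLefschetz_nodalForms_uniform)
    (hGIC : Literature.AlgebraicGeometry.HodgeTheory.deligne_globalInvariantCycles)
    (hCDK : Literature.AlgebraicGeometry.HodgeTheory.cmsp_nonHodgeGenericPoints_countable_algebraic_cover)
    (hB2 : Literature.AlgebraicGeometry.HodgeTheory.picardLefschetz_symmetricA3) :
    Summit.HodgeConjecture.HodgeConjecture.Theses.SignSymmetricPowers.VeryGeneralSignCommutatorsInHg :=
  veryGeneralSignCommutatorsInHg_of_six_facts_kernel
    (Griffiths1969_residueKernel_eq_jacobianIdeal_of_residues_primitive hG5) @hZvK @hPL @hGIC @hCDK @hB2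

end Summit.HodgeConjecture.HodgeConjecture.Theorems.SignSymmetricPowersSixFacts

end
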